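import Literature.MathematicalPhysics.QuantumLattice.InterClusterKernelSymmetries
import Literature.MathematicalPhysics.QuantumLattice.HubbardWave0LiebProofs
import HarnessLib

/-!
# Particle-number selection rules of the pair resolvent and of the inter-cluster kernel

Topic `MathematicalPhysics/QuantumLattice`; continues `ClusterPairBosonCouplings.lean` /
`InterClusterKernelSymmetries.lean`. The docstring of `interClusterKernel` records that "wrong-sector
terms vanish when the `φ`'s are particle-number eigenstates (`H` conserving `N`)"; this file PROVES
it. Everything is elementary support bookkeeping on the Jordan–Wigner Fock space
`Fock ι = (Finset ι → ℂ)` (`IsNParticle N ψ`: `ψ` is supported on configurations of cardinality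
`N`):

* a matrix commuting with a diagonal matrix has no entries between different level sets of the
  diagonal (`apply_eq_zero_of_commute_diagonal`), hence maps each particle-number sector into itself
  when it commutes with `N̂ = totalNumberOp = diag(#s)` (`IsNParticle.mulVec_of_commute_totalNumberOp`);
  Kato's eigenprojections `eigenProj H s` of a particle-number conserving `H` therefore preserve the
  sectors (`IsNParticle.eigenProj_mulVec`), and their matrix elements between different sectors
  vanish (`dotProduct_eigenProj_mulVec_eq_zero_of_ne`);
* consequently the pair resolvent `pairResolvent hH E a b c d` VANISHES as soon as `a, b` (or `c, d`)
  lie in different particle-number sectors (`pairResolvent_eq_zero_of_isNParticle_ne₁₂/₃₄`; via the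
  spectral-projection form `pairResolvent_eq_sum_eigenProj`), and whenever one argument is the zero
  vector (`pairResolvent_zero₁…₄`);
* `c_i` kills the zero-particle sector and lowers every other sector by one
  (`IsNParticle.annihilation_mulVec_pred`, from `IsNParticle.annihilation_mulVec_holds` of the tree),
  `c†_i` raises by one (`IsNParticle.creation_mulVec_holds`);
* **SELECTION RULE** (`interClusterKernel_eq_zero_of_isNParticle`): if `H` conserves the particle
  number and the cluster states `φ_k` carry `n_k` particles, the entry `(κ', κ)` of
  `interClusterKernel hH φ W` vanishes unless one of the three charge bookkeepings of its four
  processes holds — pair transfer `1 → 2` (`n_{κ.1} = n_{κ'.1} + 2 ∧ n_{κ'.2} = n_{κ.2} + 2`),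
  pair transfer `2 → 1` (`n_{κ'.1} = n_{κ.1} + 2 ∧ n_{κ.2} = n_{κ'.2} + 2`), or out-and-back
  (`n_{κ'.1} = n_{κ.1} ∧ n_{κ'.2} = n_{κ.2}`). For Hubbard clusters (`hamiltonian G t U`, which
  commutes with `N`, `hamiltonian_isHermitian_and_commute_holds`) and sector ground states this is
  `interClusterKernel_hamiltonian_eq_zero_of_mem_szSector`.

For the `2 × 2` plaquette (`n₀ = 4`, `n₁ = 2`) the rule leaves exactly the four diagonal entries
and the exchange pair `((1,0),(0,1))`, `((0,1),(1,0))` of the `4 × 4` kernel — the two-plaquette form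
of the hard-core boson dictionary (Yao–Tsai–Kivelson 2007, eq. (2)); that specialisation lives with
the plaquette (Summits side).

## Mathlib / tree search

Tree: `totalNumberOp_eq_diagonal`, `totalNumberOp_eq_totalNumber` (`FermionOperators`),
`IsNParticle.annihilation_mulVec_holds`, `IsNParticle.creation_mulVec_holds`, `annihilation_apply`
(`FermionOperatorsProofs`), `hamiltonian_isHermitian_and_commute_holds` (`HubbardWave0LiebProofs`),
`mem_szSector_iff` (`HubbardModel`), `pairResolvent_eq_sum_eigenProj`, `commute_eigenProj_of_commute`,
`pairResolvent_smul₁…₄` (`InterClusterKernelSymmetries`);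
`ThermodynamicLimit.dotProduct_eq_zero_of_isNParticle_ne` exists in
`HubbardModelThermodynamicLimitProofs` (not imported here; the three-line orthogonality is re-derived
in the form needed). `lean search 'selection|wrong-sector|pairResolvent_eq_zero'`: nothing.

## References

* T. Kato, *Perturbation theory for linear operators* (1966), I-§5.3 (eigenprojections commute with
  the symmetries of the operator). [Kato1966]
* W.-F. Tsai, S. A. Kivelson, PRB 73 (2006) 214510, App. A (A1)–(A3) (intermediate states of fixed
  charge on each plaquette). [TsaiKivelson2006]
* H. Yao, W.-F. Tsai, S. A. Kivelson, PRB 76 (2007) 161104(R), eq. (2). [YaoTsaiKivelson2007]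
-/

noncomputable section

namespace Literature.MathematicalPhysics.QuantumLattice

open Matrix Finset

/-! ### Matrices commuting with a diagonal matrix -/

section Diagonal

variable {n : Type*} [Fintype n] [DecidableEq n]

/-- A matrix commuting with a diagonal matrix has no entries between different level sets of the
diagonal: `[M, diag d] = 0`, `d s ≠ d t ⇒ M s t = 0`. [folklore] -/
theorem apply_eq_zero_of_commute_diagonal {M : Matrix n n ℂ} {d : n → ℂ} (h : Commute M (diagonal d))
    {s t : n} (hst : d s ≠ d t) : M s t = 0 := by
  have h1 := congrFun (congrFun h.eq s) t
  rw [mul_diagonal, diagonal_mul] at h1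
  -- `M s t * d t = d s * M s t`
  have h2 : M s t * (d t - d s) = 0 := by rw [mul_sub, h1]; ring
  rcases mul_eq_zero.1 h2 with h3 | h3
  · exact h3
  · exact absurd (sub_eq_zero.1 h3).symm hst

/-- A matrix commuting with `diag d` maps vectors supported in the level set `{d = c}` into vectors
supported in the same level set. [folklore] -/
theorem mulVec_apply_eq_zero_of_commute_diagonal {M : Matrix n n ℂ} {d : n → ℂ}
    (h : Commute M (diagonal d)) {v : n → ℂ} {c : ℂ} (hv : ∀ t, d t ≠ c → v t = 0) {s : n}
    (hs : d s ≠ c) : (M *ᵥ v) s = 0 := by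
  rw [mulVec, dotProduct]
  refine Finset.sum_eq_zero fun t _ => ?_
  by_cases ht : d t = c
  · rw [apply_eq_zero_of_commute_diagonal h (by rw [ht]; exact hs), zero_mul]
  · rw [hv t ht, mul_zero]

end Diagonal

/-! ### Particle-number sectors of the Jordan–Wigner Fock space -/

section Fock

variable {ι : Type*} [LinearOrder ι] [Fintype ι]

/-- **An operator commuting with `N̂` preserves every particle-number sector.** [folklore] -/
theorem IsNParticle.mulVec_of_commute_totalNumberOp {M : Matrix (Finset ι) (Finset ι) ℂ}
    (hM : Commute M totalNumberOp) {N : ℕ} {ψ : Fock ι} (hψ : IsNParticle N ψ) :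
    IsNParticle N (M *ᵥ ψ) := by
  rw [totalNumberOp_eq_diagonal] at hM
  intro s hs
  refine mulVec_apply_eq_zero_of_commute_diagonal hM (c := (N : ℂ)) (fun t ht => hψ t ?_) ?_
  · exact fun htN => ht (by rw [htN])
  · exact fun hsN => hs (by exact_mod_cast hsN)

/-- Kato's eigenprojections of a particle-number conserving `H` preserve the sectors.
[cite: Kato1966, I-§5.3 (5.26)] -/
theorem IsNParticle.eigenProj_mulVec {H : Matrix (Finset ι) (Finset ι) ℂ}
    (hHN : Commute H totalNumberOp) (s : ℝ) {N : ℕ} {ψ : Fock ι} (hψ : IsNParticle N ψ) :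
    IsNParticle N (eigenProj H s *ᵥ ψ) :=
  IsNParticle.mulVec_of_commute_totalNumberOp (commute_eigenProj_of_commute hHN.symm s) hψ

omit [LinearOrder ι] in
/-- Vectors of different particle-number sectors are orthogonal. [folklore] -/
theorem IsNParticle.star_dotProduct_eq_zero_of_ne {N M : ℕ} {ψ φ : Fock ι} (hψ : IsNParticle N ψ)
    (hφ : IsNParticle M φ) (h : N ≠ M) : star ψ ⬝ᵥ φ = 0 := by
  rw [dotProduct]
  refine Finset.sum_eq_zero fun s _ => ?_
  by_cases hs : s.card = N
  · rw [hφ s (hs ▸ h), mul_zero]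
  · rw [Pi.star_apply, hψ s hs, star_zero, zero_mul]

/-- **Matrix elements of the eigenprojections between different sectors vanish**:
`⟨a, P_s b⟩ = 0` for `a` with `Na` particles, `b` with `Nb ≠ Na` particles, `[H, N̂] = 0`.
[cite: Kato1966, I-§5.3 (5.26)] -/
theorem dotProduct_eigenProj_mulVec_eq_zero_of_ne {H : Matrix (Finset ι) (Finset ι) ℂ}
    (hHN : Commute H totalNumberOp) (s : ℝ) {Na Nb : ℕ} {a b : Fock ι} (ha : IsNParticle Na a)
    (hb : IsNParticle Nb b) (hne : Na ≠ Nb) : star a ⬝ᵥ (eigenProj H s *ᵥ b) = 0 :=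
  ha.star_dotProduct_eq_zero_of_ne (hb.eigenProj_mulVec hHN s) hne

/-! ### Vanishing of the pair resolvent -/

/-- **Wrong-sector vanishing (first pair)**: if `a` and `b` lie in different particle-number
sectors of a particle-number conserving `H`, then `K(E; a,b; c,d) = 0` for all `c, d`.
[cite: TsaiKivelson2006, App. A (A1)] -/
theorem pairResolvent_eq_zero_of_isNParticle_ne₁₂ {H : Matrix (Finset ι) (Finset ι) ℂ}
    (hH : H.IsHermitian) (hHN : Commute H totalNumberOp) (E : ℝ) {Na Nb : ℕ} {a b : Fock ι}
    (ha : IsNParticle Na a) (hb : IsNParticle Nb b) (hne : Na ≠ Nb) (c d : Fock ι) :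
    pairResolvent hH E a b c d = 0 := by
  rw [pairResolvent_eq_sum_eigenProj]
  refine Finset.sum_eq_zero fun s _ => Finset.sum_eq_zero fun t _ => ?_
  rw [dotProduct_eigenProj_mulVec_eq_zero_of_ne hHN s ha hb hne, zero_mul, zero_mul]

/-- **Wrong-sector vanishing (second pair)**: if `c` and `d` lie in different particle-number
sectors then `K(E; a,b; c,d) = 0` for all `a, b`. [cite: TsaiKivelson2006, App. A (A1)] -/
theorem pairResolvent_eq_zero_of_isNParticle_ne₃₄ {H : Matrix (Finset ι) (Finset ι) ℂ}
    (hH : H.IsHermitian) (hHN : Commute H totalNumberOp) (E : ℝ) (a b : Fock ι) {Nc Nd : ℕ}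
    {c d : Fock ι} (hc : IsNParticle Nc c) (hd : IsNParticle Nd d) (hne : Nc ≠ Nd) :
    pairResolvent hH E a b c d = 0 := by
  rw [pairResolvent_swap, pairResolvent_eq_zero_of_isNParticle_ne₁₂ hH hHN E hc hd hne]

variable {A : Matrix (Finset ι) (Finset ι) ℂ}

omit [LinearOrder ι] in
/-- `K(E; 0,b; c,d) = 0`. [folklore] -/
theorem pairResolvent_zero₁ [DecidableEq (Finset ι)] (hA : A.IsHermitian) (E : ℝ) (b c d : Fock ι) :
    pairResolvent hA E 0 b c d = 0 := by
  simpa using pairResolvent_smul₁ hA E 0 0 b c d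

omit [LinearOrder ι] in
/-- `K(E; a,0; c,d) = 0`. [folklore] -/
theorem pairResolvent_zero₂ [DecidableEq (Finset ι)] (hA : A.IsHermitian) (E : ℝ) (a c d : Fock ι) :
    pairResolvent hA E a 0 c d = 0 := by
  simpa using pairResolvent_smul₂ hA E 0 a 0 c d

omit [LinearOrder ι] in
/-- `K(E; a,b; 0,d) = 0`. [folklore] -/
theorem pairResolvent_zero₃ [DecidableEq (Finset ι)] (hA : A.IsHermitian) (E : ℝ) (a b d : Fock ι) :
    pairResolvent hA E a b 0 d = 0 := by
  simpa using pairResolvent_smul₃ hA E 0 a b 0 d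

omit [LinearOrder ι] in
/-- `K(E; a,b; c,0) = 0`. [folklore] -/
theorem pairResolvent_zero₄ [DecidableEq (Finset ι)] (hA : A.IsHermitian) (E : ℝ) (a b c : Fock ι) :
    pairResolvent hA E a b c 0 = 0 := by
  simpa using pairResolvent_smul₄ hA E 0 a b c 0

/-! ### `c_i` and `c†_i` on the sectors -/

/-- `c_i` lowers a positive particle number by one. [cite: BratteliRobinsonII1997, §5.2.2] -/
theorem IsNParticle.annihilation_mulVec_pred {N : ℕ} {ψ : Fock ι} (hψ : IsNParticle N ψ) (hN : N ≠ 0)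
    (i : ι) : IsNParticle (N - 1) (annihilation i *ᵥ ψ) := by
  obtain ⟨m, rfl⟩ := Nat.exists_eq_succ_of_ne_zero hN
  rw [Nat.succ_sub_one]
  exact IsNParticle.annihilation_mulVec_holds hψ i

/-! ### The selection rule of the inter-cluster kernel -/

variable {K : Type*} {H : Matrix (Finset ι) (Finset ι) ℂ}

/-- **Particle-number selection rule of the inter-cluster kernel.** Let `H` conserve the particle
number and let every cluster state `φ_k` carry `n_k` particles. The entry `(κ', κ)` of
`interClusterKernel hH φ W` (bra `κ'`, ket `κ`) is a sum of four second-order processes whose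
intermediate one-cluster vectors are `c†φ_{κ'.1} / cφ_{κ.1}` etc.; by the orthogonality of sectors
(through the spectral-projection form of the pair resolvent) each process vanishes unless its charge
bookkeeping matches: pair transfer `1 → 2` needs `n_{κ.1} = n_{κ'.1} + 2` and
`n_{κ'.2} = n_{κ.2} + 2`; pair transfer `2 → 1` needs `n_{κ'.1} = n_{κ.1} + 2` and
`n_{κ.2} = n_{κ'.2} + 2`; the two out-and-back processes need `n_{κ'.1} = n_{κ.1}` and
`n_{κ'.2} = n_{κ.2}`. If none of the three holds, the entry is `0` ("wrong-sector terms vanish").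
[cite: TsaiKivelson2006, App. A (A1)–(A3)] -/
theorem interClusterKernel_eq_zero_of_isNParticle (hH : H.IsHermitian) (hHN : Commute H totalNumberOp)
    (φ : K → Fock ι) (nφ : K → ℕ) (hφ : ∀ k, IsNParticle (nφ k) (φ k)) (W : ι → ι → ℝ)
    (κ' κ : K × K) (h₁ : ¬ (nφ κ.1 = nφ κ'.1 + 2 ∧ nφ κ'.2 = nφ κ.2 + 2))
    (h₂ : ¬ (nφ κ'.1 = nφ κ.1 + 2 ∧ nφ κ.2 = nφ κ'.2 + 2))
    (h₃ : ¬ (nφ κ'.1 = nφ κ.1 ∧ nφ κ'.2 = nφ κ.2)) :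
    interClusterKernel hH φ W κ' κ = 0 := by
  -- creation raises, annihilation lowers (or kills)
  have hcr : ∀ (k : K) (i : ι), IsNParticle (nφ k + 1) (creation i *ᵥ φ k) :=
    fun k i => IsNParticle.creation_mulVec_holds (hφ k) i
  have han : ∀ (k : K) (i : ι), nφ k ≠ 0 → IsNParticle (nφ k - 1) (annihilation i *ᵥ φ k) :=
    fun k i hk => (hφ k).annihilation_mulVec_pred hk i
  -- `c_i` kills the zero-particle sector (`c_i |∅⟩ = 0`; cf. the `NoGo` route's lemma of the same name)
  have han0 : ∀ (k : K) (i : ι), nφ k = 0 → annihilation i *ᵥ φ k = 0 := by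
    intro k i hk
    have hψ : IsNParticle 0 (φ k) := hk ▸ hφ k
    funext s
    simp only [mulVec, dotProduct, annihilation_apply, Pi.zero_apply]
    refine Finset.sum_eq_zero fun t _ => ?_
    split_ifs with h
    · rw [hψ t (by rw [h.2, card_insert_of_notMem h.1]; omega), mul_zero]
    · rw [zero_mul]
  set E := (pairEnergy H φ κ + pairEnergy H φ κ') / 2 with hE
  -- the four processes vanish separately
  have t1 : ∀ i j i' j', pairResolvent hH E (creation i' *ᵥ φ κ'.1) (annihilation i *ᵥ φ κ.1)
      (annihilation j' *ᵥ φ κ'.2) (creation j *ᵥ φ κ.2) = 0 := by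
    intro i j i' j'
    by_cases hA : nφ κ.1 = nφ κ'.1 + 2
    · have hB : nφ κ'.2 ≠ nφ κ.2 + 2 := fun hB => h₁ ⟨hA, hB⟩
      by_cases h0 : nφ κ'.2 = 0
      · rw [han0 _ j' h0, pairResolvent_zero₃]
      · exact pairResolvent_eq_zero_of_isNParticle_ne₃₄ hH hHN E _ _ (han _ j' h0) (hcr _ j) (by omega)
    · by_cases h0 : nφ κ.1 = 0
      · rw [han0 _ i h0, pairResolvent_zero₂]
      · exact pairResolvent_eq_zero_of_isNParticle_ne₁₂ hH hHN E (hcr _ i') (han _ i h0) (by omega) _ _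
  have t2 : ∀ i j i' j', pairResolvent hH E (annihilation i' *ᵥ φ κ'.1) (creation i *ᵥ φ κ.1)
      (creation j' *ᵥ φ κ'.2) (annihilation j *ᵥ φ κ.2) = 0 := by
    intro i j i' j'
    by_cases hA : nφ κ'.1 = nφ κ.1 + 2
    · have hB : nφ κ.2 ≠ nφ κ'.2 + 2 := fun hB => h₂ ⟨hA, hB⟩
      by_cases h0 : nφ κ.2 = 0
      · rw [han0 _ j h0, pairResolvent_zero₄]
      · exact pairResolvent_eq_zero_of_isNParticle_ne₃₄ hH hHN E _ _ (hcr _ j') (han _ j h0) (by omega)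
    · by_cases h0 : nφ κ'.1 = 0
      · rw [han0 _ i' h0, pairResolvent_zero₁]
      · exact pairResolvent_eq_zero_of_isNParticle_ne₁₂ hH hHN E (han _ i' h0) (hcr _ i) (by omega) _ _
  have t3 : ∀ i j i' j', pairResolvent hH E (annihilation i' *ᵥ φ κ'.1) (annihilation i *ᵥ φ κ.1)
      (creation j' *ᵥ φ κ'.2) (creation j *ᵥ φ κ.2) = 0 := by
    intro i j i' j'
    by_cases hA : nφ κ'.1 = nφ κ.1
    · have hB : nφ κ'.2 ≠ nφ κ.2 := fun hB => h₃ ⟨hA, hB⟩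
      exact pairResolvent_eq_zero_of_isNParticle_ne₃₄ hH hHN E _ _ (hcr _ j') (hcr _ j) (by omega)
    · by_cases h0 : nφ κ'.1 = 0
      · rw [han0 _ i' h0, pairResolvent_zero₁]
      · by_cases h0' : nφ κ.1 = 0
        · rw [han0 _ i h0', pairResolvent_zero₂]
        · exact pairResolvent_eq_zero_of_isNParticle_ne₁₂ hH hHN E (han _ i' h0) (han _ i h0')
            (by omega) _ _
  have t4 : ∀ i j i' j', pairResolvent hH E (creation i' *ᵥ φ κ'.1) (creation i *ᵥ φ κ.1)
      (annihilation j' *ᵥ φ κ'.2) (annihilation j *ᵥ φ κ.2) = 0 := by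
    intro i j i' j'
    by_cases hA : nφ κ'.1 = nφ κ.1
    · have hB : nφ κ'.2 ≠ nφ κ.2 := fun hB => h₃ ⟨hA, hB⟩
      by_cases h0 : nφ κ'.2 = 0
      · rw [han0 _ j' h0, pairResolvent_zero₃]
      · by_cases h0' : nφ κ.2 = 0
        · rw [han0 _ j h0', pairResolvent_zero₄]
        · exact pairResolvent_eq_zero_of_isNParticle_ne₃₄ hH hHN E _ _ (han _ j' h0) (han _ j h0')
            (by omega)
    · exact pairResolvent_eq_zero_of_isNParticle_ne₁₂ hH hHN E (hcr _ i') (hcr _ i) (by omega) _ _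
  unfold interClusterKernel
  refine Finset.sum_eq_zero fun i _ => Finset.sum_eq_zero fun j _ =>
    Finset.sum_eq_zero fun i' _ => Finset.sum_eq_zero fun j' _ => ?_
  rw [← hE, t1, t2, t3, t4]
  ring

end Fock

/-! ### Hubbard clusters -/

section Hubbard

open HubbardWave0

variable {Λ : Type*} [LinearOrder Λ] [Fintype Λ] {K : Type*}

/-- The Hubbard Hamiltonian of a finite graph commutes with the total number operator of the
Jordan–Wigner orbitals (`totalNumberOp = totalNumber`, `hamiltonian_isHermitian_and_commute_holds`).
[cite: arXiv9311033, §2] -/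
theorem hamiltonian_commute_totalNumberOp (G : SimpleGraph Λ) [DecidableRel G.Adj] (t U : ℝ) :
    Commute (hamiltonian G t U) (totalNumberOp : Matrix (Finset (Orb Λ)) (Finset (Orb Λ)) ℂ) := by
  rw [totalNumberOp_eq_totalNumber]
  exact (hamiltonian_isHermitian_and_commute_holds G t U).2.1

/-- A vector of the joint sector `(N, S^z = M)` carries `N` particles. [folklore] -/
theorem isNParticle_of_mem_szSector {N : ℕ} {M : ℝ} {ψ : Fock (Orb Λ)} (hψ : ψ ∈ szSector N M) :
    IsNParticle N ψ :=
  ((mem_szSector_iff N M ψ).1 hψ).1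

/-- **Selection rule for Hubbard cluster states.** For the Hubbard Hamiltonian of a finite graph and
cluster states in joint sectors `(n_k, S^z = m_k)`, the entry `(κ', κ)` of the inter-cluster kernel
vanishes unless the charge bookkeeping of one of its processes matches (pair transfer `1 → 2`,
pair transfer `2 → 1`, or out-and-back). [cite: TsaiKivelson2006, App. A (A1)–(A3)] -/
theorem interClusterKernel_hamiltonian_eq_zero_of_mem_szSector (G : SimpleGraph Λ) [DecidableRel G.Adj]
    (t U : ℝ) (hH : (hamiltonian G t U).IsHermitian) (φ : K → Fock (Orb Λ)) (nφ : K → ℕ)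
    (mφ : K → ℝ) (hφ : ∀ k, φ k ∈ szSector (nφ k) (mφ k)) (W : Orb Λ → Orb Λ → ℝ) (κ' κ : K × K)
    (h₁ : ¬ (nφ κ.1 = nφ κ'.1 + 2 ∧ nφ κ'.2 = nφ κ.2 + 2))
    (h₂ : ¬ (nφ κ'.1 = nφ κ.1 + 2 ∧ nφ κ.2 = nφ κ'.2 + 2))
    (h₃ : ¬ (nφ κ'.1 = nφ κ.1 ∧ nφ κ'.2 = nφ κ.2)) :
    interClusterKernel hH φ W κ' κ = 0 :=
  interClusterKernel_eq_zero_of_isNParticle hH (hamiltonian_commute_totalNumberOp G t U) φ nφ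
    (fun k => isNParticle_of_mem_szSector (hφ k)) W κ' κ h₁ h₂ h₃

end Hubbard

end Literature.MathematicalPhysics.QuantumLattice

end
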